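import Summits.NavierStokesRegularity.NavierStokesRegularity.Theorems.ScenarioCensusRowA1FModes

/-!
# Census row A1F — part 2/2: bounded ancient finite-mode solutions vanish (energy identity); census keys

Re-homed for the scenario census (typer seat ns-census-typer-1 g5; lead g7 MINT INTENT A1F 2026-08-28T16:20Z / ACK REV 5 16:46Z,
GO 16:49Z «A1F port: bohr-meter REV 5 block freqSq :117 … row_A1F_holds :488») from ns-idea-2 g10's LINE «bohr-meter» REV 5
(`pub/ideators/ns-idea-2/lines/bohr-meter/line-bohr-meter.lean`, sha16 38276969af99c456; ref g7 PRE-CHECK ✓ 16:24Z / 16:47Z;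
critic RE-STAMP CONFORMS 16:43Z; lit LABEL 16:23Z: one-line corollary of Kishimoto–Yoneda, JMFM 2022, Thm 5.1, not verbatim in
print), in two files for the 400-line rule: `ScenarioCensusRowA1FModes` (the class, the row, S1 `FourierEnergyNull` PROVED) →
`ScenarioCensusRowA1F` (the energy argument `row_A1F_of_stubs`, `row_A1F_holds`, census keys).  Lean text of the A1F block verbatim
in namespace `…Theorems.ScenarioCensus.BohrMeter` (the line's `…Lines.BohrMeter` re-homed; docstrings added to the `KY.dot` algebra);
the almost-periodic rows (A1trig / A1apT / A1ap, stubs S2 / M3 / M3trig) are NOT re-homed (in-row displays, files-only).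

No census value is asserted here (the lead books A1F); NS regularity is NOT proved; no summit statement is proved by this file.
-/

noncomputable section

set_option linter.unusedVariables false
set_option linter.dupNamespace false
set_option linter.style.longLine false

namespace Summit.NavierStokesRegularity.NavierStokesRegularity.Theorems.ScenarioCensus.BohrMeter

open Set Function Filter Topology MeasureTheory Finset
open scoped BigOperators
open Literature.Analysis Literature.Analysis.FluidPDE
open Summit.NavierStokesRegularity.NavierStokesRegularity

/-- Calculus helper (tree `Literature.Analysis.ODE.hasDerivAt_normSq`, specialised to `ℂ`):
`d/dt ‖f‖² = 2 Re (conj f · f')`. -/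
theorem hasDerivAt_norm_sq_comp {f : ℝ → ℂ} {f' : ℂ} {x : ℝ} (hf : HasDerivAt f f' x) :
    HasDerivAt (fun y => ‖f y‖ ^ 2) (2 * ((starRingEnd ℂ) (f x) * f').re) x := by
  have h := Literature.Analysis.ODE.hasDerivAt_normSq hf
  simpa using h

/-- `|n|² > 0` off the origin. -/
theorem freqSq_pos {n : Fin 3 → ℝ} (hn : n ≠ 0) : 0 < freqSq n := by
  by_contra hle
  push Not at hle
  have hsum : ∑ i, n i ^ 2 = 0 :=
    le_antisymm hle (Finset.sum_nonneg fun i _ => sq_nonneg (n i))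
  apply hn
  funext i
  have hi := (Finset.sum_eq_zero_iff_of_nonneg (fun j _ => sq_nonneg (n j))).1 hsum i (Finset.mem_univ i)
  exact pow_eq_zero_iff (two_ne_zero) |>.1 hi

/-- **Composition (PROVED): S1 ⇒ Row A1F.**  Energy–gap–Gronwall extinction. -/
theorem row_A1F_of_stubs (hS1 : FourierEnergyNull) : Row_A1F := by
  intro S c hc n t ht
  classical
  by_cases hn : n ∈ S
  swap
  · exact hc.eq_zero_of_notMem n hn t
  have hSne : S.Nonempty := ⟨n, hn⟩
  have hmem_ne : ∀ m ∈ S, m ≠ 0 := fun m hm h => hc.zero_notMem (h ▸ hm)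
  -- the spectral gap
  set μ : ℝ := S.inf' hSne freqSq with hμ
  have hμle : ∀ m ∈ S, μ ≤ freqSq m := fun m hm => Finset.inf'_le _ hm
  have hμpos : 0 < μ := by
    obtain ⟨m, hm, hmeq⟩ := Finset.exists_mem_eq_inf' hSne freqSq
    rw [hμ, hmeq]; exact freqSq_pos (hmem_ne m hm)
  -- the energy
  set E : ℝ → ℝ := fun s => ∑ m ∈ S, ∑ i : Fin 3, ‖c m s i‖ ^ 2 with hE
  have hE_nonneg : ∀ s, 0 ≤ E s := fun s =>
    Finset.sum_nonneg fun m _ => Finset.sum_nonneg fun i _ => sq_nonneg _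
  -- its derivative
  have hderiv : ∀ s < 0,
      HasDerivAt E (-2 * ∑ m ∈ S, freqSq m * ∑ i : Fin 3, ‖c m s i‖ ^ 2) s := by
    intro s hs
    have hcd : ∀ m (i : Fin 3), HasDerivAt (fun τ => c m τ i) (deriv (fun τ => c m τ i) s) s :=
      fun m i => ((hc.differentiableOn m i).differentiableAt (Iio_mem_nhds hs)).hasDerivAt
    have h1 : HasDerivAt E
        (∑ m ∈ S, ∑ i : Fin 3, 2 * ((starRingEnd ℂ) (c m s i) * deriv (fun τ => c m τ i) s).re) s := by
      rw [hE]
      exact HasDerivAt.fun_sum fun m hm => HasDerivAt.fun_sum fun i _ => hasDerivAt_norm_sq_comp (hcd m i)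
    convert h1 using 1
    have hns : ∀ m ∈ S, ∀ i : Fin 3, deriv (fun τ => c m τ i) s =
        -((freqSq m : ℂ) * c m s i) - KY.nonlin S (fun q => c q s) m i := by
      intro m hm i
      have := hc.ns m (hmem_ne m hm) s hs i
      linear_combination this
    have hnull := hS1 S (fun q => c q s) hc.zero_notMem hc.neg_mem
      (fun q hq => hc.eq_zero_of_notMem q hq s) (fun q => hc.conj q s) (fun q hq => hc.div_free q hq s hs)
    have hnull' : ∑ m ∈ S, ∑ i : Fin 3,
        ((starRingEnd ℂ) (c m s i) * KY.nonlin S (fun q => c q s) m i).re = 0 := by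
      rw [Complex.re_sum] at hnull
      simpa [Complex.re_sum] using hnull
    have key : ∀ m ∈ S, ∀ i : Fin 3,
        2 * ((starRingEnd ℂ) (c m s i) * deriv (fun τ => c m τ i) s).re =
          -2 * (freqSq m * ‖c m s i‖ ^ 2) -
            2 * ((starRingEnd ℂ) (c m s i) * KY.nonlin S (fun q => c q s) m i).re := by
      intro m hm i
      rw [hns m hm i, ← Complex.normSq_eq_norm_sq]
      simp only [Complex.mul_re, Complex.sub_re, Complex.sub_im, Complex.neg_re, Complex.neg_im,
        Complex.conj_re, Complex.conj_im, Complex.ofReal_re, Complex.ofReal_im, Complex.normSq_apply,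
        Complex.mul_im]
      ring
    rw [Finset.sum_congr rfl (fun m hm => Finset.sum_congr rfl (fun i _ => key m hm i))]
    simp only [Finset.sum_sub_distrib, ← Finset.mul_sum]
    rw [hnull']
    ring
  -- E' ≤ -2 μ E
  have hderiv_le : ∀ s < 0,
      -2 * ∑ m ∈ S, freqSq m * ∑ i : Fin 3, ‖c m s i‖ ^ 2 ≤ -2 * μ * E s := by
    intro s hs
    have : μ * E s ≤ ∑ m ∈ S, freqSq m * ∑ i : Fin 3, ‖c m s i‖ ^ 2 := by
      rw [hE]; dsimp only
      rw [Finset.mul_sum]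
      exact Finset.sum_le_sum fun m hm =>
        mul_le_mul_of_nonneg_right (hμle m hm) (Finset.sum_nonneg fun i _ => sq_nonneg _)
    linarith
  -- F := e^{2μs} E(s) is antitone on (−∞,0)
  set F : ℝ → ℝ := fun s => Real.exp (2 * μ * s) * E s with hF
  have hFd : ∀ s < 0, HasDerivAt F (Real.exp (2 * μ * s) * (2 * μ) * E s +
      Real.exp (2 * μ * s) * (-2 * ∑ m ∈ S, freqSq m * ∑ i : Fin 3, ‖c m s i‖ ^ 2)) s := by
    intro s hs
    have hexp : HasDerivAt (fun σ => Real.exp (2 * μ * σ)) (Real.exp (2 * μ * s) * (2 * μ)) s := by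
      have h1 : HasDerivAt (fun σ => 2 * μ * σ) (2 * μ) s := by
        simpa using (hasDerivAt_id s).const_mul (2 * μ)
      exact (Real.hasDerivAt_exp (2 * μ * s)).comp s h1
    exact hexp.mul (hderiv s hs)
  have hFd_le : ∀ s < 0, Real.exp (2 * μ * s) * (2 * μ) * E s +
      Real.exp (2 * μ * s) * (-2 * ∑ m ∈ S, freqSq m * ∑ i : Fin 3, ‖c m s i‖ ^ 2) ≤ 0 := by
    intro s hs
    have h1 := hderiv_le s hs
    have hpos := Real.exp_pos (2 * μ * s)
    nlinarith
  have hanti : AntitoneOn F (Iio 0) := by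
    apply antitoneOn_of_deriv_nonpos (convex_Iio 0)
    · exact fun s hs => (hFd s hs).continuousAt.continuousWithinAt
    · rw [interior_Iio]; exact fun s hs => (hFd s hs).differentiableAt.differentiableWithinAt
    · rw [interior_Iio]; intro s hs; rw [(hFd s hs).deriv]; exact hFd_le s hs
  -- a bound on E in the past of t
  obtain ⟨B, hB⟩ := hc.bounded t ht
  set B' : ℝ := ∑ m ∈ S, ∑ i : Fin 3, B ^ 2 with hB'
  have hEB : ∀ s ≤ t, E s ≤ B' := by
    intro s hs
    rw [hE, hB']
    apply Finset.sum_le_sum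
    intro m hm
    apply Finset.sum_le_sum
    intro i _
    have h1 : ‖c m s i‖ ≤ B := (norm_le_pi_norm (c m s) i).trans (hB m s hs)
    exact pow_le_pow_left₀ (norm_nonneg _) h1 2
  have hB'nn : 0 ≤ B' := by
    rw [hB']; exact Finset.sum_nonneg fun m _ => Finset.sum_nonneg fun i _ => sq_nonneg B
  -- extinction at time t
  suffices hEt : E t = 0 by
    have h0 : ∀ i : Fin 3, ‖c n t i‖ ^ 2 = 0 := by
      intro i
      have h1 := (Finset.sum_eq_zero_iff_of_nonneg (fun m _ =>
        Finset.sum_nonneg fun j _ => sq_nonneg ‖c m t j‖)).1 hEt n hn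
      exact (Finset.sum_eq_zero_iff_of_nonneg (fun j _ => sq_nonneg ‖c n t j‖)).1 h1 i
        (Finset.mem_univ i)
    funext i
    exact norm_eq_zero.1 (pow_eq_zero_iff two_ne_zero |>.1 (h0 i))
  by_contra hne
  have he : 0 < E t := lt_of_le_of_ne (hE_nonneg t) (Ne.symm hne)
  set e := E t with he_def
  set L : ℝ := (B' + 1) / (2 * μ * e) with hL
  have hLpos : 0 < L := by rw [hL]; positivity
  have h2μL : 2 * μ * L = (B' + 1) / e := by
    rw [hL]; field_simp
  have hexp : (B' + 1) / e < Real.exp (2 * μ * L) := by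
    rw [← h2μL]
    exact lt_of_lt_of_le (by linarith) (Real.add_one_le_exp (2 * μ * L))
  set s := t - L with hs_def
  have hst : s < t := by rw [hs_def]; linarith
  have hs0 : s < 0 := hst.trans ht
  have hFts : F t ≤ F s := hanti (show s ∈ Iio (0:ℝ) from hs0) (show t ∈ Iio (0:ℝ) from ht) hst.le
  have hFt : F t = Real.exp (2 * μ * s) * (Real.exp (2 * μ * L) * e) := by
    rw [hF]; dsimp only
    rw [he_def, ← mul_assoc, ← Real.exp_add]; congr 1; rw [hs_def]; ring_nf
  have hFs : F s ≤ Real.exp (2 * μ * s) * B' := by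
    rw [hF]; dsimp only
    exact mul_le_mul_of_nonneg_left (hEB s hst.le) (Real.exp_pos _).le
  have h3 : Real.exp (2 * μ * L) * e ≤ B' := by
    have := hFts; rw [hFt] at this
    exact le_of_mul_le_mul_left (this.trans hFs) (Real.exp_pos _)
  have h4 : B' + 1 < Real.exp (2 * μ * L) * e := by
    have := mul_lt_mul_of_pos_right hexp he
    rwa [div_mul_cancel₀ _ (ne_of_gt he)] at this
  linarith

/-! ## 2. The x-space rung: trigonometric-polynomial slices in the Type-I gauge class -/

/-- **Rung `Row_A1F` CLOSED IN KERNEL (REV 2):** a bounded ancient solution of the Fourier-side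
Navier–Stokes system with finite symmetric support `S ∌ 0` is zero — no stub remains upstream. -/
theorem row_A1F_holds : Row_A1F := row_A1F_of_stubs fourierEnergyNull_holds


end Summit.NavierStokesRegularity.NavierStokesRegularity.Theorems.ScenarioCensus.BohrMeter

namespace Summit.NavierStokesRegularity.NavierStokesRegularity.Theorems.ScenarioCensus

/-- Census row A1F — (any type · ancient, Fourier side · no symmetry; instead FINITE symmetric Fourier support `S ∌ 0` (real
frequencies, no lattice assumption) · bounded on past half-lines): every bounded ancient finite-mode solution of the Fourier-side
Navier–Stokes system (viscosity `1`) is zero, BY NAME `BohrMeter.Row_A1F` (ns-idea-2 LINE «bohr-meter» REV 5, VERBATIM).  Closed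
by `row_A1F_excluded`; the census lead books the value. -/
def Row_A1F : Prop := BohrMeter.Row_A1F

/-- A1F is PROVED in the tree: `BohrMeter.row_A1F_holds` (S1 `fourierEnergyNull_holds` + the energy identity on the finite mode
set).  No summit proved. -/
theorem row_A1F_excluded : Row_A1F := BohrMeter.row_A1F_holds

end Summit.NavierStokesRegularity.NavierStokesRegularity.Theorems.ScenarioCensus

end
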